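import Summits.AtomisticToContinuum.Crystallization.Theorems.GapTwelveToBarlow.Negative.PairSumObstruction
import Summits.AtomisticToContinuum.Crystallization.Theorems.GapTwelveToBarlow.Negative.WitnessLattice

/-!
# Negative knowledge for crux `SquareWellLayerCake.GapTwelveToBarlow` (stmt-AtomisticToContinuum-15807), III:
# the energy-free reading is FALSE — Barlow windows need minimality already at the first shell
# (standing disprover, cycle 1; supports 15807)

`gapTwelveToBarlow_false_without_isGroundState`: the crux with `∀ N, IsGroundState lennardJones (x N)`
DELETED (`Negative.PairSumObstruction.GapTwelveToBarlowWithoutIsGroundState`, everything else verbatim) is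
FALSE.  Witness (`witness`): a box of `2n³` sites of the lattice of `Negative.WitnessLattice` (`n = side N`,
the largest `n` with `2n³ ≤ N`) plus `N − 2n³ = O(n²)` far-away spares.  Every interior site is Good
(`good_witness`), so the non-Good fraction is `O(N^{-1/3}) → 0` (`tendsto_not_good_witness`, the crux's
hypothesis); but NO interior site is `(1, 1/100)`-matched to any Barlow template (`not_matched_witness`, by
the pair-sum obstruction with the defect `(±1/25, 0, 0)`), so the unmatched fraction tends to `1`
(`not_tendsto_not_matched_witness`, failure of the conclusion at `R = 1`, `ε = 1/100`).

CONSEQUENCE (load-bearing analysis).  Any proof of K3 must use `IsGroundState`, and must use it to kill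
strain at the scale of SINGLE bonds (`R = 1`), not only mesoscopic strain gradients: the hypothesis
tolerates a `3.5 %` bond window (and this witness uses bonds `1, 0.995, 0.967`), while the conclusion for
`ε → 0` tolerates no alternation of bond lengths or layer gaps above `2ε`.  Nothing here closes an item;
no theorem concludes a Theses decl.
-/

noncomputable section

open scoped BigOperators
open Filter Topology

namespace Summit.AtomisticToContinuum.Crystallization.Theorems.GapTwelveToBarlow.Negative.WithoutGroundState

open Literature.MathematicalPhysics.StatisticalMechanics
open Summit.AtomisticToContinuum.Crystallization.Theorems.GapTwelveToBarlow.Negative.PairSumObstruction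
open Summit.AtomisticToContinuum.Crystallization.Theorems.GapTwelveToBarlow.Negative.WitnessLattice

/-! ## §4 The witness configurations: a box of the lattice plus far-away spare particles -/

/-- Labels of the box of side `n`: layers `0 ≤ ℓ < 2n`, columns `0 ≤ p, q < n` (`2n³` sites). -/
def boxIdx (n : ℕ) : Finset (ℤ × ℤ × ℤ) :=
  (Finset.Ico (0 : ℤ) (2 * n)) ×ˢ ((Finset.Ico (0 : ℤ) n) ×ˢ (Finset.Ico (0 : ℤ) n))

/-- Labels of the interior of the box: `1 ≤ ℓ ≤ 2n − 2`, `1 ≤ p, q ≤ n − 2`. -/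
def interiorIdx (n : ℕ) : Finset (ℤ × ℤ × ℤ) :=
  (Finset.Ico (1 : ℤ) (2 * n - 1)) ×ˢ ((Finset.Ico (1 : ℤ) (n - 1)) ×ˢ (Finset.Ico (1 : ℤ) (n - 1)))

/-- Membership in the box. -/
theorem mem_boxIdx {n : ℕ} {u : ℤ × ℤ × ℤ} :
    u ∈ boxIdx n ↔ (0 ≤ u.1 ∧ u.1 < 2 * n) ∧ (0 ≤ u.2.1 ∧ u.2.1 < n) ∧ (0 ≤ u.2.2 ∧ u.2.2 < n) := by
  simp only [boxIdx, Finset.mem_product, Finset.mem_Ico]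

/-- Membership in the interior. -/
theorem mem_interiorIdx {n : ℕ} {u : ℤ × ℤ × ℤ} :
    u ∈ interiorIdx n ↔
      (1 ≤ u.1 ∧ u.1 < 2 * n - 1) ∧ (1 ≤ u.2.1 ∧ u.2.1 < n - 1) ∧ (1 ≤ u.2.2 ∧ u.2.2 < n - 1) := by
  simp only [interiorIdx, Finset.mem_product, Finset.mem_Ico]

/-- The box has `2n³` labels. -/
theorem card_boxIdx (n : ℕ) : (boxIdx n).card = 2 * n ^ 3 := by
  simp only [boxIdx, Finset.card_product, Int.card_Ico, sub_zero]
  have h1 : ((2 : ℤ) * n).toNat = 2 * n := by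
    rw [show ((2 : ℤ) * n) = ((2 * n : ℕ) : ℤ) by push_cast; ring, Int.toNat_natCast]
  rw [h1, Int.toNat_natCast]
  ring

/-- The interior has `(2n − 2)(n − 2)²` labels (`n ≥ 2`). -/
theorem card_interiorIdx {n : ℕ} (hn : 2 ≤ n) : (interiorIdx n).card = (2 * n - 2) * (n - 2) ^ 2 := by
  simp only [interiorIdx, Finset.card_product, Int.card_Ico]
  have h1 : ((2 : ℤ) * n - 1 - 1).toNat = 2 * n - 2 := by
    rw [show ((2 : ℤ) * n - 1 - 1) = ((2 * n - 2 : ℕ) : ℤ) by push_cast [show 2 ≤ 2 * n by omega]; ring,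
      Int.toNat_natCast]
  have h2 : ((n : ℤ) - 1 - 1).toNat = n - 2 := by
    rw [show ((n : ℤ) - 1 - 1) = ((n - 2 : ℕ) : ℤ) by push_cast [hn]; ring, Int.toNat_natCast]
  rw [h1, h2]
  ring

/-- The interior is inside the box. -/
theorem interiorIdx_subset (n : ℕ) : interiorIdx n ⊆ boxIdx n := by
  intro u hu
  rw [mem_interiorIdx] at hu
  rw [mem_boxIdx]
  omega

/-- All twelve neighbours of an interior label are box labels. -/
theorem nbr_mem_boxIdx {n : ℕ} {u : ℤ × ℤ × ℤ} (hu : u ∈ interiorIdx n) (t : Fin 12) :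
    nbr u t ∈ boxIdx n := by
  obtain ⟨ℓ, p, q⟩ := u
  simp only [mem_interiorIdx] at hu
  obtain ⟨⟨h1, h2⟩, ⟨h3, h4⟩, ⟨h5, h6⟩⟩ := hu
  rw [mem_boxIdx]
  have hr : 0 ≤ ℓ % 2 ∧ ℓ % 2 ≤ 1 := by omega
  fin_cases t <;> simp [nbr, nbrOff] <;> omega

/-- The side of the box used for `N` particles: the largest `n` with `2n³ ≤ N`. -/
def side (N : ℕ) : ℕ := Nat.findGreatest (fun n => 2 * n ^ 3 ≤ N) N

/-- `2 (side N)³ ≤ N`. -/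
theorem two_mul_side_pow_le (N : ℕ) : 2 * side N ^ 3 ≤ N :=
  Nat.findGreatest_spec (P := fun n => 2 * n ^ 3 ≤ N) (Nat.zero_le N) (by simp)

/-- Maximality of `side N`. -/
theorem le_side {N m : ℕ} (h : 2 * m ^ 3 ≤ N) : m ≤ side N := by
  refine Nat.le_findGreatest ?_ h
  calc m ≤ m ^ 3 := Nat.le_self_pow (by norm_num) m
    _ ≤ 2 * m ^ 3 := by omega
    _ ≤ N := h

/-- `N < 2 (side N + 1)³`. -/
theorem lt_two_mul_side_succ_pow (N : ℕ) : N < 2 * (side N + 1) ^ 3 := by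
  by_contra hN
  push Not at hN
  have := le_side hN
  omega

/-- `side N → ∞`. -/
theorem side_tendsto_atTop : Tendsto side atTop atTop := by
  refine tendsto_atTop_atTop.2 fun K => ⟨2 * K ^ 3, fun N hN => le_side hN⟩

/-- The box fits into `Fin N`. -/
theorem card_boxIdx_side_le (N : ℕ) : (boxIdx (side N)).card ≤ N := by
  rw [card_boxIdx]; exact two_mul_side_pow_le N

/-- Spare particles, far away on the negative first axis and `1` apart from each other. -/
def junk (i : ℕ) : (EuclideanSpace ℝ (Fin 3)) := !₂[-(5 : ℝ) - i, 0, 0]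

/-- First coordinate of a spare. -/
@[simp] theorem junk_apply_zero (i : ℕ) : junk i 0 = -(5 : ℝ) - i := rfl

/-- **THE WITNESS SEQUENCE.**  For `N` particles: the box of side `side N` of the lattice of §3
(`2 (side N)³` sites, enumerated by `Finset.equivFin`), the remaining `N − 2 (side N)³ = O(N^{2/3})`
particles parked far away. -/
def witness (N : ℕ) : Fin N → (EuclideanSpace ℝ (Fin 3)) := fun i =>
  if hi : (i : ℕ) < (boxIdx (side N)).card then pos ((boxIdx (side N)).equivFin.symm ⟨i, hi⟩).1
  else junk i

/-- The index in `Fin N` of the box site labelled `u`. -/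
def idx (N : ℕ) (u : ℤ × ℤ × ℤ) (hu : u ∈ boxIdx (side N)) : Fin N :=
  ⟨((boxIdx (side N)).equivFin ⟨u, hu⟩ : ℕ),
    lt_of_lt_of_le (Fin.is_lt _) (card_boxIdx_side_le N)⟩

/-- The particle indexed by a box label sits at that label's position. -/
@[simp] theorem witness_idx (N : ℕ) (u : ℤ × ℤ × ℤ) (hu : u ∈ boxIdx (side N)) :
    witness N (idx N u hu) = pos u := by
  unfold witness idx
  simp only [Fin.is_lt, ↓reduceDIte, Fin.eta, Equiv.symm_apply_apply]

/-- Distinct labels index distinct particles. -/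
theorem idx_injective {N : ℕ} {u v : ℤ × ℤ × ℤ} (hu : u ∈ boxIdx (side N)) (hv : v ∈ boxIdx (side N))
    (h : idx N u hu = idx N v hv) : u = v := by
  unfold idx at h
  simp only [Fin.mk.injEq] at h
  have := (boxIdx (side N)).equivFin.injective (Fin.ext h)
  simpa using this

/-- A particle whose index is below the box count sits at the position of its label. -/
theorem witness_of_lt {N : ℕ} (j : Fin N) (hj : (j : ℕ) < (boxIdx (side N)).card) :
    ∃ (u : ℤ × ℤ × ℤ) (hu : u ∈ boxIdx (side N)), idx N u hu = j ∧ witness N j = pos u := by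
  refine ⟨((boxIdx (side N)).equivFin.symm ⟨j, hj⟩).1, ((boxIdx (side N)).equivFin.symm ⟨j, hj⟩).2,
    ?_, ?_⟩
  · unfold idx
    ext
    simp only [Subtype.coe_eta, Equiv.apply_symm_apply]
  · unfold witness
    simp only [hj, ↓reduceDIte]

/-- A particle beyond the box count is a spare. -/
theorem witness_of_le {N : ℕ} (j : Fin N) (hj : (boxIdx (side N)).card ≤ (j : ℕ)) :
    witness N j = junk j := by
  unfold witness
  simp only [not_lt.2 hj, ↓reduceDIte]

/-- Box sites have non-negative first coordinate. -/
theorem pos_apply_zero_nonneg {n : ℕ} {u : ℤ × ℤ × ℤ} (hu : u ∈ boxIdx n) : 0 ≤ pos u 0 := by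
  rw [mem_boxIdx] at hu
  rw [pos_apply_zero]
  have h1 : (0 : ℝ) ≤ (u.1 : ℝ) := by exact_mod_cast hu.1.1
  have h2 : (0 : ℝ) ≤ ((u.1 % 2 : ℤ) : ℝ) := by exact_mod_cast (Int.emod_nonneg u.1 two_ne_zero)
  positivity

/-- Spares are at distance `≥ 5` from every box site. -/
theorem five_le_dist_junk_pos {n : ℕ} {u : ℤ × ℤ × ℤ} (hu : u ∈ boxIdx n) (i : ℕ) :
    (5 : ℝ) ≤ dist (junk i) (pos u) := by
  refine le_trans ?_ (PiLp.dist_apply_le (junk i) (pos u) 0)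
  rw [junk_apply_zero, Real.dist_eq]
  have := pos_apply_zero_nonneg hu
  have hi : (0 : ℝ) ≤ i := Nat.cast_nonneg i
  rw [abs_of_nonpos (by linarith)]
  linarith

/-- **Separation**: every box particle is `55/57`-separated from every other particle. -/
theorem sep_witness {N : ℕ} {j k : Fin N} (hjk : k ≠ j) (hj : (j : ℕ) < (boxIdx (side N)).card) :
    (55 : ℝ) / 57 ≤ dist (witness N j) (witness N k) := by
  obtain ⟨u, hu, rfl, hju⟩ := witness_of_lt j hj
  rw [hju]
  by_cases hk : (k : ℕ) < (boxIdx (side N)).card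
  · obtain ⟨v, hv, rfl, hkv⟩ := witness_of_lt k hk
    rw [hkv, dist_comm]
    refine le_dist_pos ?_
    rintro rfl
    exact hjk rfl
  · rw [witness_of_le k (not_lt.1 hk), dist_comm]
    exact le_trans (by norm_num) (five_le_dist_junk_pos hu k)

/-- A particle within `11/10` of a box particle is a box particle. -/
theorem lt_card_of_dist_le {N : ℕ} {u : ℤ × ℤ × ℤ} (hu : u ∈ boxIdx (side N)) {k : Fin N}
    (hk : dist (pos u) (witness N k) ≤ 11 / 10) : (k : ℕ) < (boxIdx (side N)).card := by
  by_contra hk'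
  rw [witness_of_le k (not_lt.1 hk'), dist_comm] at hk
  have := five_le_dist_junk_pos hu k
  linarith

/-- **Every interior box particle is Good** for the crux's hypothesis predicate. -/
theorem good_witness {N : ℕ} {u : ℤ × ℤ × ℤ} (hu : u ∈ interiorIdx (side N)) :
    Good (witness N) (idx N u (interiorIdx_subset _ hu)) := by
  classical
  have hub : u ∈ boxIdx (side N) := interiorIdx_subset _ hu
  set i : Fin N := idx N u hub with hi
  have hxi : witness N i = pos u := witness_idx N u hub
  refine ⟨?_, ?_⟩
  · -- separation of the 11/10-neighbourhood
    intro j hj k hkj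
    rw [hxi] at hj
    exact sep_witness hkj (lt_card_of_dist_le hub hj)
  · -- the counts: I = image of the twelve neighbours
    set I : Finset (Fin N) := Finset.univ.image fun t : Fin 12 => idx N (nbr u t) (nbr_mem_boxIdx hu t)
      with hI
    set S := Finset.univ.filter fun j : Fin N => j ≠ i ∧ dist (witness N i) (witness N j) ≤ 1 with hS
    set T := Finset.univ.filter fun j : Fin N => j ≠ i ∧ dist (witness N i) (witness N j) ≤ 11 / 10
      with hT
    have hIcard : I.card = 12 := by
      rw [hI, Finset.card_image_of_injective _ ?_, Finset.card_univ, Fintype.card_fin]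
      intro t t' htt
      exact nbr_injective u (idx_injective _ _ htt)
    have hIS : I ⊆ S := by
      intro j hj
      rw [hI, Finset.mem_image] at hj
      obtain ⟨t, -, rfl⟩ := hj
      rw [hS, Finset.mem_filter]
      refine ⟨Finset.mem_univ _, ?_, ?_⟩
      · intro h
        exact nbr_ne u t (idx_injective _ _ h)
      · rw [hxi, witness_idx, dist_comm]
        exact dist_nbr_le u t
    have hST : S ⊆ T := by
      intro j hj
      rw [hS, Finset.mem_filter] at hj
      rw [hT, Finset.mem_filter]
      exact ⟨hj.1, hj.2.1, hj.2.2.trans (by norm_num)⟩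
    have hTI : T ⊆ I := by
      intro j hj
      rw [hT, Finset.mem_filter] at hj
      obtain ⟨-, hji, hdist⟩ := hj
      rw [hxi] at hdist
      obtain ⟨v, hv, rfl, hjv⟩ := witness_of_lt j (lt_card_of_dist_le hub hdist)
      rw [hjv, dist_comm] at hdist
      have hvu : v ≠ u := by
        rintro rfl
        exact hji rfl
      have hd2 : dist (pos v) (pos u) ^ 2 ≤ 121 / 100 := by
        have h0 : 0 ≤ dist (pos v) (pos u) := dist_nonneg
        calc dist (pos v) (pos u) ^ 2 ≤ (11 / 10) ^ 2 := pow_le_pow_left₀ h0 hdist 2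
          _ = 121 / 100 := by norm_num
      obtain ⟨t, rfl⟩ := eq_nbr_of_dist_sq_le hvu hd2
      rw [hI, Finset.mem_image]
      exact ⟨t, Finset.mem_univ _, rfl⟩
    have h1 : 12 ≤ S.card := hIcard ▸ Finset.card_le_card hIS
    have h2 : T.card ≤ 12 := hIcard ▸ Finset.card_le_card hTI
    have h3 : S.card ≤ T.card := Finset.card_le_card hST
    exact ⟨by omega, by omega⟩

/-- **No interior box particle is `(1, 1/100)`-matched** (pair-sum obstruction of §2 with the defect
`(±1/25, 0, 0)` of `norm_pairSum_nbr`). -/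
theorem not_matched_witness {N : ℕ} {u : ℤ × ℤ × ℤ} (hu : u ∈ interiorIdx (side N)) :
    ¬ Matched 1 (1 / 100) (witness N) (idx N u (interiorIdx_subset _ hu)) := by
  have hub : u ∈ boxIdx (side N) := interiorIdx_subset _ hu
  have h4 := witness_idx N (nbr u 4) (nbr_mem_boxIdx hu 4)
  have h11 := witness_idx N (nbr u 11) (nbr_mem_boxIdx hu 11)
  have h0 := witness_idx N u hub
  refine not_matched_of_short_pairSum (j := idx N (nbr u 4) (nbr_mem_boxIdx hu 4))
    (k := idx N (nbr u 11) (nbr_mem_boxIdx hu 11)) ?_ ?_ ?_ ?_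
  · rw [h4, h0]; exact dist_nbr_le u 4
  · rw [h11, h0]; exact dist_nbr_le u 11
  · rw [h4, h11, h0, norm_pairSum_nbr]; norm_num
  · rw [h4, h11, h0, norm_pairSum_nbr]; norm_num

/-! ## §5 Counting and the limits -/

/-- The interior labels, as a type, inject into the Good particles. -/
theorem card_interior_le_card_good (N : ℕ) :
    (interiorIdx (side N)).card ≤ Nat.card {i : Fin N // Good (witness N) i} := by
  rw [← Nat.card_eq_finsetCard]
  refine Nat.card_le_card_of_injective
    (fun u : interiorIdx (side N) => (⟨idx N u.1 (interiorIdx_subset _ u.2), good_witness u.2⟩ :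
      {i : Fin N // Good (witness N) i})) ?_
  intro u v h
  simp only [Subtype.mk.injEq] at h
  exact Subtype.ext (idx_injective _ _ h)

/-- The interior labels, as a type, inject into the unmatched particles at `(R, ε) = (1, 1/100)`. -/
theorem card_interior_le_card_not_matched (N : ℕ) :
    (interiorIdx (side N)).card ≤ Nat.card {i : Fin N // ¬ Matched 1 (1 / 100) (witness N) i} := by
  rw [← Nat.card_eq_finsetCard]
  refine Nat.card_le_card_of_injective
    (fun u : interiorIdx (side N) => (⟨idx N u.1 (interiorIdx_subset _ u.2), not_matched_witness u.2⟩ :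
      {i : Fin N // ¬ Matched 1 (1 / 100) (witness N) i})) ?_
  intro u v h
  simp only [Subtype.mk.injEq] at h
  exact Subtype.ext (idx_injective _ _ h)

/-- Complementary count: bad = all − good. -/
theorem card_not_good_eq (N : ℕ) :
    (Nat.card {i : Fin N // ¬ Good (witness N) i} : ℝ) = N - Nat.card {i : Fin N // Good (witness N) i} := by
  classical
  rw [Nat.card_eq_fintype_card, Nat.card_eq_fintype_card, Fintype.card_subtype_compl, Nat.cast_sub,
    Fintype.card_fin]
  exact Fintype.card_subtype_le _

/-- Lower bound for the interior count: `#interior ≥ 2n³ − 10n²` (`n = side N ≥ 2`). -/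
theorem card_interior_ge {n : ℕ} (hn : 2 ≤ n) :
    (2 : ℝ) * n ^ 3 - 10 * n ^ 2 ≤ ((interiorIdx n).card : ℝ) := by
  rw [card_interiorIdx hn]
  have h1 : ((2 * n - 2 : ℕ) : ℝ) = 2 * n - 2 := by
    rw [Nat.cast_sub (by omega)]; push_cast; ring
  have h2 : ((n - 2 : ℕ) : ℝ) = n - 2 := by
    rw [Nat.cast_sub hn]; push_cast; ring
  push_cast [h1, h2]
  have hn' : (2 : ℝ) ≤ n := by exact_mod_cast hn
  nlinarith

/-- **The hypothesis of the crux holds for the witness**: the non-Good fraction tends to `0`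
(it is `O(N^{-1/3})`: only the box boundary and the spares are bad). -/
theorem tendsto_not_good_witness :
    Tendsto (fun N : ℕ => (Nat.card {i : Fin N // ¬ Good (witness N) i} : ℝ) / N) atTop (𝓝 0) := by
  have hbound : ∀ N : ℕ, 2 ≤ side N →
      (Nat.card {i : Fin N // ¬ Good (witness N) i} : ℝ) / N ≤ 13 / (side N : ℝ) := by
    intro N hn
    set n := side N with hndef
    have hN1 : (2 : ℝ) * n ^ 3 ≤ N := by exact_mod_cast two_mul_side_pow_le N
    have hN2 : (N : ℝ) < 2 * (n + 1) ^ 3 := by exact_mod_cast lt_two_mul_side_succ_pow N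
    have hn' : (2 : ℝ) ≤ n := by exact_mod_cast hn
    have hNpos : (0 : ℝ) < N := by nlinarith
    have hnpos : (0 : ℝ) < n := by linarith
    have hgood : (2 : ℝ) * n ^ 3 - 10 * n ^ 2 ≤ Nat.card {i : Fin N // Good (witness N) i} :=
      (card_interior_ge hn).trans (by exact_mod_cast card_interior_le_card_good N)
    rw [card_not_good_eq, div_le_div_iff₀ hNpos hnpos]
    nlinarith
  have hlim : Tendsto (fun N : ℕ => (13 : ℝ) / (side N : ℝ)) atTop (𝓝 0) :=
    tendsto_const_nhds.div_atTop (tendsto_natCast_atTop_atTop.comp side_tendsto_atTop)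
  have hev : ∀ᶠ N : ℕ in atTop, 2 ≤ side N := (side_tendsto_atTop.eventually (eventually_ge_atTop 2))
  refine squeeze_zero' (Eventually.of_forall fun N => by positivity) ?_ hlim
  filter_upwards [hev] with N hN using hbound N hN

/-- **The conclusion of the crux fails for the witness** at `(R, ε) = (1, 1/100)`: the unmatched fraction
is eventually `≥ 1/2` (indeed `→ 1`). -/
theorem not_tendsto_not_matched_witness :
    ¬ Tendsto (fun N : ℕ => (Nat.card {i : Fin N // ¬ Matched 1 (1 / 100) (witness N) i} : ℝ) / N)
      atTop (𝓝 0) := by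
  intro hT
  have hbound : ∀ N : ℕ, 20 ≤ side N →
      (1 : ℝ) / 2 ≤ (Nat.card {i : Fin N // ¬ Matched 1 (1 / 100) (witness N) i} : ℝ) / N := by
    intro N hn
    set n := side N with hndef
    have hN2 : (N : ℝ) < 2 * (n + 1) ^ 3 := by exact_mod_cast lt_two_mul_side_succ_pow N
    have hn' : (20 : ℝ) ≤ n := by exact_mod_cast hn
    have hN1 : (2 : ℝ) * n ^ 3 ≤ N := by exact_mod_cast two_mul_side_pow_le N
    have hNpos : (0 : ℝ) < N := by nlinarith
    have hbad : (2 : ℝ) * n ^ 3 - 10 * n ^ 2 ≤ Nat.card {i : Fin N // ¬ Matched 1 (1 / 100) (witness N) i} :=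
      (card_interior_ge (by omega)).trans (by exact_mod_cast card_interior_le_card_not_matched N)
    rw [le_div_iff₀ hNpos]
    nlinarith
  have hev : ∀ᶠ N : ℕ in atTop, 20 ≤ side N := side_tendsto_atTop.eventually (eventually_ge_atTop 20)
  have hsmall : ∀ᶠ N : ℕ in atTop,
      (Nat.card {i : Fin N // ¬ Matched 1 (1 / 100) (witness N) i} : ℝ) / N < 1 / 2 :=
    hT.eventually (gt_mem_nhds (by norm_num))
  obtain ⟨N, hN1, hN2⟩ := (hev.and hsmall).exists
  have := hbound N hN1
  linarith

/-! ## §6 Main negative result -/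

/-- **LOAD-BEARING ANALYSIS — the energy-free reading of `GapTwelveToBarlow` is FALSE.**
Deleting the hypothesis `∀ N, IsGroundState lennardJones (x N)` from the crux (keeping the gap-twelve
hypothesis verbatim) gives a false statement: the witness sequence `witness` (fcc with (100) gaps alternating
`7/10, 33/50`; every bulk site has exactly twelve neighbours at distances `1, √0.99, √0.9356 ∈ [55/57, 1]`,
nothing in `(1, 11/10]`, everything `55/57`-separated) has non-Good fraction `→ 0`, yet at
`(R, ε) = (1, 1/100)` NO bulk site is matched to any `barlowStacking a h s` (`a, h > 1/2`, any `s, z, A`),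
because its up/down neighbour offsets sum to `(±1/25, 0, 0)` while Barlow windows are centrosymmetric modulo
`Λ*(a) ⊕ hℤe₃` (min norm `> 1/(2√3)`) to precision `2ε = 1/50 < 1/25`.  Hence ANY proof of the crux must use
minimality, and must use it to kill strain at the level of SINGLE bonds (`R = 1`), not only mesoscopic
strain gradients: the conclusion's template tolerates no bond-length/gap alternation above `2ε`, while the
hypothesis tolerates `3.5 %`. -/
theorem gapTwelveToBarlow_false_without_isGroundState : ¬ GapTwelveToBarlowWithoutIsGroundState := by
  intro hW
  exact not_tendsto_not_matched_witness
    (hW witness tendsto_not_good_witness 1 (1 / 100) one_pos (by norm_num) (by norm_num))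

end Summit.AtomisticToContinuum.Crystallization.Theorems.GapTwelveToBarlow.Negative.WithoutGroundState
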